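import Literature.NumberTheory.Sieve.HeathBrownCubicTypeITools
import HarnessLib

/-!
# Heath-Brown's Lemma 4.4: `τ(I) ≤ 2^{n−1} τ(J)^{2n−1}` for a divisor `J ∣ I` with `N(J) ≤ N(I)^{1/n}`

Pure-proof file (no definitions, no named facts) in the decomposition of **Heath-Brown's Type II estimate, Lemma 3.10**
(`HeathBrown2001_lemma_3_10` of `HeathBrownCubicTypeII`), D. R. Heath-Brown, *Primes represented by
`x³ + 2y³`*, Acta Math. 186 (2001), 1–84.  The divisor-sum estimates of §4 used in §§11–13
(Lemmas 4.5–4.7) rest on the following device (**Lemma 4.4**, p. 23): "Let `n` be a positive integer.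
For any number field `k` and any non-zero integral ideal `I` of `k` there is an ideal `J ∣ I` with
`N(J) ≤ N(I)^{1/n}` and `τ(I) ≤ 2^{n−1} τ(J)^{2n−1}`."  Printed proof: "write `I = I₁I₂`, where `I₁` is
the product of all prime ideal divisors of `I` with norm at most `N(I)^{1/n}`. Then `I₂` is a product of
at most `n − 1` primes, whence `τ(I₂) ≤ 2^{n−1}`. We can write `I₁` as a product `J₁ ⋯ J_t` with
`N(J_i) ≤ N(I)^{1/n}` and `N(J_rJ_s) > N(I)^{1/n}` for `r ≠ s`. It follows that `t ≤ 2n − 1`. We therefore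
deduce that `τ(I) ≤ 2^{n−1}τ(I₁) ≤ 2^{n−1} ∏ τ(J_i) ≤ 2^{n−1}(max τ(J_i))^t ≤ 2^{n−1}(max τ(J_i))^{2n−1}`."

This file PROVES the lemma for the ideals of `𝓞_K`, `K = ℚ(2^{1/3})` (the only field needed), with the
tree's divisor function `idealDivisorCount` (`τ`):

* `idealDivisorCount_le_two_of_prime`, `idealDivisorCount_multiset_prod_le` (`τ(P₁⋯P_r) ≤ 2^r`),
  `idealDivisorCount_list_prod_le` (`τ(∏ J_i) ≤ ∏ τ(J_i)`, Lemma 4.3);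
* the greedy grouping `exists_blocks` of a list of prime factors into consecutive blocks of norm
  `≤ Y` (we only arrange `N(J_rJ_{r+1}) > Y` for CONSECUTIVE blocks, which is what the count
  `t ≤ 2n − 1` uses);
* `pow_length_div_two_le_absNorm_prod` (a chain `J₁, …, J_t` with `N(J_rJ_{r+1}) > Y` has
  `N(∏J_i) ≥ Y^{⌊t/2⌋}`, strictly if `t ≥ 2`);
* **`HeathBrown2001_lemma_4_4`** — the lemma.

## References

* D. R. Heath-Brown, *Primes represented by `x³ + 2y³`*, Acta Math. 186 (2001), 1–84: Lemma 4.4, p. 23.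
  [cite: HeathBrownActa2001, Lemma 4.4]

## Mathlib / tree search

Mathlib: `UniqueFactorizationMonoid.normalizedFactors`, `prime_of_normalized_factor`,
`Ideal.prod_normalizedFactors_eq_self`, `Ideal.prime_iff_isPrime`, `Ideal.IsMaximal.eq_of_le`,
`Multiset.filter_add_not`, `List.IsChain`, `Real.rpow_inv_natCast_pow`; no divisor-function combinatorics
for ideals. Tree: `HeathBrownCubicTypeITools` (`idealDivisorCount_mul_le` = Lemma 4.3,
`idealDivisorCount_le_of_dvd`, `one_le_idealDivisorCount`), `HeathBrownCubicSieveSetup`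
(`idealDivisorCount`, `idealsLE`).
-/

noncomputable section

open NumberField Finset UniqueFactorizationMonoid

namespace Literature.NumberTheory.Sieve.CubicSieve

open LFunctions.CubeRootTwoField

/-! ### `τ` of primes and of products -/

/-- A divisor of a non-zero prime ideal is the ideal itself or the unit ideal. [folklore] -/
theorem dvd_prime_ideal_iff {P D : Ideal (𝓞 K)} (hP : P.IsPrime) (hP0 : P ≠ ⊥) (hD : D ∣ P) :
    D = P ∨ D = ⊤ := by
  by_cases hDt : D = ⊤
  · exact Or.inr hDt
  · left
    exact ((hP.isMaximal hP0).eq_of_le hDt (Ideal.le_of_dvd hD)).symm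

/-- `τ(P) ≤ 2` for a non-zero prime ideal `P`. [folklore] -/
theorem idealDivisorCount_le_two_of_prime {P : Ideal (𝓞 K)} (hP : P.IsPrime) (hP0 : P ≠ ⊥) :
    idealDivisorCount P ≤ 2 := by
  classical
  unfold idealDivisorCount
  calc #{D ∈ idealsLE (Ideal.absNorm P) | D ∣ P} ≤ #({P, ⊤} : Finset (Ideal (𝓞 K))) := by
        refine card_le_card fun D hD => ?_
        rw [mem_filter] at hD
        rw [mem_insert, mem_singleton]
        exact dvd_prime_ideal_iff hP hP0 hD.2
    _ ≤ 2 := card_le_two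

/-- `τ` of a product of `r` non-zero prime ideals is at most `2^r` (Lemma 4.3 iterated).
[cite: HeathBrownActa2001, Lemma 4.3] -/
theorem idealDivisorCount_multiset_prod_le (s : Multiset (Ideal (𝓞 K)))
    (hs : ∀ P ∈ s, P.IsPrime ∧ P ≠ ⊥) :
    idealDivisorCount s.prod ≤ 2 ^ Multiset.card s := by
  induction s using Multiset.induction_on with
  | empty =>
    simp only [Multiset.prod_zero, Multiset.card_zero, pow_zero]
    -- `τ(1) = 1`
    classical
    unfold idealDivisorCount
    refine (card_le_card (t := {⊤}) fun D hD => ?_).trans (card_singleton _).le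
    rw [mem_filter] at hD
    rw [mem_singleton]
    exact Ideal.isUnit_iff.mp (isUnit_of_dvd_one hD.2)
  | cons P s ih =>
    have hP := hs P (Multiset.mem_cons_self P s)
    have hs' : ∀ Q ∈ s, Q.IsPrime ∧ Q ≠ ⊥ := fun Q hQ => hs Q (Multiset.mem_cons_of_mem hQ)
    have hs0 : s.prod ≠ ⊥ := Multiset.prod_ne_zero fun h => (hs' _ h).2 rfl
    rw [Multiset.prod_cons, Multiset.card_cons, pow_succ']
    calc idealDivisorCount (P * s.prod) ≤ idealDivisorCount P * idealDivisorCount s.prod :=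
          idealDivisorCount_mul_le hP.2 hs0
      _ ≤ 2 * 2 ^ Multiset.card s :=
          Nat.mul_le_mul (idealDivisorCount_le_two_of_prime hP.1 hP.2) (ih hs')

/-- `τ(J₁⋯J_t) ≤ ∏ τ(J_i)` for non-zero ideals (Lemma 4.3 iterated). [cite: HeathBrownActa2001, Lemma 4.3] -/
theorem idealDivisorCount_list_prod_le (L : List (Ideal (𝓞 K))) (hL : ∀ J ∈ L, J ≠ ⊥) :
    idealDivisorCount L.prod ≤ (L.map idealDivisorCount).prod := by
  induction L with
  | nil =>
    simp only [List.prod_nil, List.map_nil]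
    classical
    unfold idealDivisorCount
    refine (card_le_card (t := {⊤}) fun D hD => ?_).trans (card_singleton _).le
    rw [mem_filter] at hD
    rw [mem_singleton]
    exact Ideal.isUnit_iff.mp (isUnit_of_dvd_one hD.2)
  | cons J L ih =>
    have hJ := hL J (List.mem_cons_self)
    have hL' : ∀ J' ∈ L, J' ≠ ⊥ := fun J' hJ' => hL J' (List.mem_cons_of_mem J hJ')
    have hL0 : L.prod ≠ ⊥ := List.prod_ne_zero fun h => hL' _ h rfl
    rw [List.prod_cons, List.map_cons, List.prod_cons]
    exact (idealDivisorCount_mul_le hJ hL0).trans (Nat.mul_le_mul_left _ (ih hL'))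

/-! ### The greedy grouping into blocks -/

/-- **Greedy grouping.** Given an accumulator `acc ≠ 0` with `N(acc) ≤ Y` and a list `ps` of non-zero
ideals of norm `≤ Y`, there is a list of "blocks" `L = (acc·J') :: tl` (`J' ≠ 0`) with
`∏ L = acc · ∏ ps`, every block non-zero of norm `≤ Y`, and consecutive blocks of product norm `> Y`
(the accumulator absorbs the next factor `p` as long as `N(acc·p) ≤ Y`, otherwise it is emitted and a
new block starts at `p`).  We only arrange `N(J_rJ_{r+1}) > Y` for CONSECUTIVE blocks, which is all
that the count `t ≤ 2n − 1` uses. [folklore] -/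
theorem exists_blocks (Y : ℝ) :
    ∀ (ps : List (Ideal (𝓞 K))) (acc : Ideal (𝓞 K)), acc ≠ ⊥ → (Ideal.absNorm acc : ℝ) ≤ Y →
      (∀ p ∈ ps, p ≠ ⊥ ∧ (Ideal.absNorm p : ℝ) ≤ Y) →
      ∃ L : List (Ideal (𝓞 K)), L.prod = acc * ps.prod ∧
        (∀ J ∈ L, J ≠ ⊥ ∧ (Ideal.absNorm J : ℝ) ≤ Y) ∧
        L.IsChain (fun a b => Y < (Ideal.absNorm (a * b) : ℝ)) ∧
        ∃ J' tl, L = (acc * J') :: tl ∧ J' ≠ ⊥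
  | [], acc, hacc0, hacc, _ =>
    ⟨[acc], by simp, by simpa using ⟨hacc0, hacc⟩, List.isChain_singleton _, 1, [], by simp,
      one_ne_zero⟩
  | p :: ps, acc, hacc0, hacc, hps => by
    have hp := hps p List.mem_cons_self
    have hps' : ∀ q ∈ ps, q ≠ ⊥ ∧ (Ideal.absNorm q : ℝ) ≤ Y := fun q hq =>
      hps q (List.mem_cons_of_mem p hq)
    by_cases h : (Ideal.absNorm (acc * p) : ℝ) ≤ Y
    · -- absorb `p`
      obtain ⟨L, hprod, hL, hch, J', tl, he, hJ'⟩ :=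
        exists_blocks Y ps (acc * p) (mul_ne_zero hacc0 hp.1) h hps'
      refine ⟨L, by rw [hprod, List.prod_cons, mul_assoc], hL, hch, p * J', tl,
        by rw [he, mul_assoc], mul_ne_zero hp.1 hJ'⟩
    · -- emit `acc`, start a new block at `p`
      obtain ⟨L, hprod, hL, hch, J', tl, he, hJ'⟩ := exists_blocks Y ps p hp.1 hp.2 hps'
      refine ⟨acc :: L, by rw [List.prod_cons, hprod, List.prod_cons], ?_, ?_, 1, L,
        by rw [mul_one], one_ne_zero⟩
      · intro J hJ
        rcases List.mem_cons.mp hJ with rfl | hJ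
        · exact ⟨hacc0, hacc⟩
        · exact hL J hJ
      · rw [he, List.isChain_cons_cons]
        refine ⟨?_, he ▸ hch⟩
        push Not at h
        -- `Y < N(acc p) ≤ N(acc p J')`
        have hJ'1 : (1 : ℝ) ≤ Ideal.absNorm J' := by
          have : Ideal.absNorm J' ≠ 0 := by rwa [Ne, Ideal.absNorm_eq_zero_iff]
          exact_mod_cast Nat.one_le_iff_ne_zero.mpr this
        calc Y < (Ideal.absNorm (acc * p) : ℝ) := h
          _ ≤ (Ideal.absNorm (acc * p) : ℝ) * Ideal.absNorm J' :=
              le_mul_of_one_le_right (by positivity) hJ'1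
          _ = (Ideal.absNorm (acc * (p * J')) : ℝ) := by
              rw [← mul_assoc, map_mul (Ideal.absNorm) (acc * p) J', Nat.cast_mul]

/-- A chain `J₁, …, J_t` of non-zero ideals with `N(J_rJ_{r+1}) > Y` (`Y ≥ 0`) has
`Y^{⌊t/2⌋} ≤ N(J₁⋯J_t)`. [folklore] -/
theorem pow_length_div_two_le_absNorm_prod {Y : ℝ} (hY : 0 ≤ Y) :
    ∀ (L : List (Ideal (𝓞 K))), (∀ J ∈ L, J ≠ ⊥) →
      L.IsChain (fun a b => Y < (Ideal.absNorm (a * b) : ℝ)) →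
        Y ^ (L.length / 2) ≤ (Ideal.absNorm L.prod : ℝ)
  | [], _, _ => by simp
  | [J], hL, _ => by
    have hJ : J ≠ ⊥ := hL J (List.mem_singleton.mpr rfl)
    have : Ideal.absNorm J ≠ 0 := by rwa [Ne, Ideal.absNorm_eq_zero_iff]
    have h1 : (1 : ℝ) ≤ Ideal.absNorm J := by exact_mod_cast Nat.one_le_iff_ne_zero.mpr this
    simpa using h1
  | a :: b :: rest, hL, hch => by
    rw [List.isChain_cons_cons] at hch
    obtain ⟨hab, hch'⟩ := hch
    have hrest : ∀ J ∈ rest, J ≠ ⊥ := fun J hJ =>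
      hL J (List.mem_cons_of_mem a (List.mem_cons_of_mem b hJ))
    have ih := pow_length_div_two_le_absNorm_prod hY rest hrest hch'.tail
    have hlen : (a :: b :: rest).length / 2 = rest.length / 2 + 1 := by
      simp only [List.length_cons]; omega
    rw [hlen, pow_succ, List.prod_cons, List.prod_cons, ← mul_assoc, map_mul, Nat.cast_mul]
    calc Y ^ (rest.length / 2) * Y ≤ (Ideal.absNorm rest.prod : ℝ) * Ideal.absNorm (a * b) :=
          mul_le_mul ih hab.le hY (by positivity)
      _ = (Ideal.absNorm (a * b) : ℝ) * Ideal.absNorm rest.prod := mul_comm _ _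

/-- Strict form: for `t ≥ 2`, `Y^{⌊t/2⌋} < N(J₁⋯J_t)`. [folklore] -/
theorem pow_length_div_two_lt_absNorm_prod {Y : ℝ} (hY : 0 ≤ Y) {L : List (Ideal (𝓞 K))}
    (hL : ∀ J ∈ L, J ≠ ⊥) (hch : L.IsChain (fun a b => Y < (Ideal.absNorm (a * b) : ℝ)))
    (hlen : 2 ≤ L.length) : Y ^ (L.length / 2) < (Ideal.absNorm L.prod : ℝ) := by
  match L, hL, hch, hlen with
  | [], _, _, h => simp at h
  | [J], _, _, h => simp at h
  | a :: b :: rest, hL, hch, _ =>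
    rw [List.isChain_cons_cons] at hch
    obtain ⟨hab, hch'⟩ := hch
    have hrest : ∀ J ∈ rest, J ≠ ⊥ := fun J hJ =>
      hL J (List.mem_cons_of_mem a (List.mem_cons_of_mem b hJ))
    have ih := pow_length_div_two_le_absNorm_prod hY rest hrest hch'.tail
    have hrest0 : rest.prod ≠ ⊥ := List.prod_ne_zero fun h => hrest _ h rfl
    have hpos : (0 : ℝ) < Ideal.absNorm rest.prod := by
      have : Ideal.absNorm rest.prod ≠ 0 := by rwa [Ne, Ideal.absNorm_eq_zero_iff]
      positivity
    have hlen : (a :: b :: rest).length / 2 = rest.length / 2 + 1 := by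
      simp only [List.length_cons]; omega
    rw [hlen, pow_succ, List.prod_cons, List.prod_cons, ← mul_assoc, map_mul, Nat.cast_mul]
    calc Y ^ (rest.length / 2) * Y ≤ (Ideal.absNorm rest.prod : ℝ) * Y :=
          mul_le_mul_of_nonneg_right ih hY
      _ < (Ideal.absNorm rest.prod : ℝ) * Ideal.absNorm (a * b) := mul_lt_mul_of_pos_left hab hpos
      _ = (Ideal.absNorm (a * b) : ℝ) * Ideal.absNorm rest.prod := mul_comm _ _

/-! ### Lemma 4.4 -/

/-- The product of a list bounds: `∏_{J ∈ L} τ(J) ≤ B^{t}` if every `τ(J) ≤ B`. [folklore] -/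
theorem list_prod_map_le_pow {L : List (Ideal (𝓞 K))} {B : ℕ}
    (hB : ∀ J ∈ L, idealDivisorCount J ≤ B) : (L.map idealDivisorCount).prod ≤ B ^ L.length := by
  induction L with
  | nil => simp
  | cons J L ih =>
    rw [List.map_cons, List.prod_cons, List.length_cons, pow_succ']
    exact Nat.mul_le_mul (hB J List.mem_cons_self) (ih fun J' hJ' => hB J' (List.mem_cons_of_mem J hJ'))

/-- **Heath-Brown's Lemma 4.4** (p. 23): "Let `n` be a positive integer. For any number field `k` and
any non-zero integral ideal `I` of `k` there is an ideal `J ∣ I` with `N(J) ≤ N(I)^{1/n}` and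
`τ(I) ≤ 2^{n−1} τ(J)^{2n−1}`" — here for `k = K = ℚ(2^{1/3})` and the divisor function
`τ = idealDivisorCount`. [cite: HeathBrownActa2001, Lemma 4.4] -/
theorem HeathBrown2001_lemma_4_4 {n : ℕ} (hn : 1 ≤ n) {I : Ideal (𝓞 K)} (hI : I ≠ ⊥) :
    ∃ J : Ideal (𝓞 K), J ∣ I ∧ (Ideal.absNorm J : ℝ) ≤ (Ideal.absNorm I : ℝ) ^ ((n : ℝ)⁻¹) ∧
      idealDivisorCount I ≤ 2 ^ (n - 1) * idealDivisorCount J ^ (2 * n - 1) := by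
  classical
  set Y : ℝ := (Ideal.absNorm I : ℝ) ^ ((n : ℝ)⁻¹) with hYdef
  have hNI : Ideal.absNorm I ≠ 0 := by rwa [Ne, Ideal.absNorm_eq_zero_iff]
  have hNI1 : (1 : ℝ) ≤ Ideal.absNorm I := by exact_mod_cast Nat.one_le_iff_ne_zero.mpr hNI
  have hY1 : 1 ≤ Y := Real.one_le_rpow hNI1 (by positivity)
  have hY0 : 0 ≤ Y := zero_le_one.trans hY1
  have hYn : Y ^ n = Ideal.absNorm I := by
    rw [hYdef, Real.rpow_inv_natCast_pow (by positivity) (by omega)]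
  -- the prime factorisation, split at `Y`
  set s := normalizedFactors I with hs
  have hsprime : ∀ P ∈ s, P.IsPrime ∧ P ≠ ⊥ := fun P hP => by
    have h := prime_of_normalized_factor P hP
    exact ⟨Ideal.isPrime_of_prime h, h.ne_zero⟩
  have hsprod : s.prod = I := Ideal.prod_normalizedFactors_eq_self hI
  set s₁ := s.filter (fun P => (Ideal.absNorm P : ℝ) ≤ Y) with hs₁
  set s₂ := s.filter (fun P => ¬(Ideal.absNorm P : ℝ) ≤ Y) with hs₂
  have hs12 : s₁ + s₂ = s := Multiset.filter_add_not _ s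
  have hI12 : s₁.prod * s₂.prod = I := by rw [← Multiset.prod_add, hs12, hsprod]
  have h1prime : ∀ P ∈ s₁, P.IsPrime ∧ P ≠ ⊥ := fun P hP => hsprime P (Multiset.mem_of_mem_filter hP)
  have h2prime : ∀ P ∈ s₂, P.IsPrime ∧ P ≠ ⊥ := fun P hP => hsprime P (Multiset.mem_of_mem_filter hP)
  have h10 : s₁.prod ≠ ⊥ := Multiset.prod_ne_zero fun h => (h1prime _ h).2 rfl
  have h20 : s₂.prod ≠ ⊥ := Multiset.prod_ne_zero fun h => (h2prime _ h).2 rfl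
  -- `I₂` has at most `n - 1` prime factors
  have hcard2 : Multiset.card s₂ ≤ n - 1 := by
    by_contra hlt
    push Not at hlt
    have hn2 : n ≤ Multiset.card s₂ := by omega
    -- `N(s₂.prod) > Y^{card s₂} ≥ Y^n = N(I) ≥ N(s₂.prod)`
    have hgt : ∀ t : Multiset (Ideal (𝓞 K)), (∀ P ∈ t, ¬(Ideal.absNorm P : ℝ) ≤ Y) →
        Y ^ Multiset.card t ≤ (Ideal.absNorm t.prod : ℝ) ∧
          (t ≠ 0 → Y ^ Multiset.card t < (Ideal.absNorm t.prod : ℝ)) := by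
      intro t
      induction t using Multiset.induction_on with
      | empty => intro _; simp
      | cons P t ih =>
        intro ht
        have hP : Y < Ideal.absNorm P := not_le.mp (ht P (Multiset.mem_cons_self P t))
        have ih' := (ih fun Q hQ => ht Q (Multiset.mem_cons_of_mem hQ)).1
        rw [Multiset.card_cons, Multiset.prod_cons, map_mul, Nat.cast_mul, pow_succ']
        have hPpos : (0 : ℝ) < Ideal.absNorm P := lt_of_le_of_lt hY0 hP
        have hYpow : 0 < Y ^ Multiset.card t := pow_pos (lt_of_lt_of_le zero_lt_one hY1) _
        constructor
        · exact mul_le_mul hP.le ih' hYpow.le hPpos.le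
        · intro _
          exact mul_lt_mul hP ih' hYpow hPpos.le
    have hs₂ne : s₂ ≠ 0 := by
      intro h0; rw [h0, Multiset.card_zero] at hn2; omega
    have hlt2 := (hgt s₂ fun P hP => (Multiset.mem_filter.mp hP).2).2 hs₂ne
    have hdvd : s₂.prod ∣ I := ⟨s₁.prod, by rw [mul_comm, hI12]⟩
    have hle : (Ideal.absNorm s₂.prod : ℝ) ≤ Ideal.absNorm I := by
      exact_mod_cast Nat.le_of_dvd (Nat.pos_of_ne_zero hNI)
        (Ideal.absNorm_dvd_absNorm_of_le (Ideal.le_of_dvd hdvd))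
    have hpow : Y ^ n ≤ Y ^ Multiset.card s₂ := pow_le_pow_right₀ hY1 hn2
    rw [hYn] at hpow
    linarith
  have hτ2 : idealDivisorCount s₂.prod ≤ 2 ^ (n - 1) :=
    (idealDivisorCount_multiset_prod_le s₂ h2prime).trans (Nat.pow_le_pow_right (by norm_num) hcard2)
  -- the blocks of `I₁`
  obtain ⟨L, hLprod, hLnorm, hLne, hLch⟩ : ∃ L : List (Ideal (𝓞 K)), L.prod = s₁.prod ∧
      (∀ J ∈ L, (Ideal.absNorm J : ℝ) ≤ Y) ∧ (∀ J ∈ L, J ≠ ⊥) ∧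
      L.IsChain (fun a b => Y < (Ideal.absNorm (a * b) : ℝ)) := by
    have hl : ∀ P ∈ s₁.toList, (Ideal.absNorm P : ℝ) ≤ Y ∧ P ≠ ⊥ := fun P hP => by
      have hP := Multiset.mem_toList.mp hP
      exact ⟨(Multiset.mem_filter.mp hP).2, (h1prime P hP).2⟩
    have hlprod : s₁.toList.prod = s₁.prod := Multiset.prod_toList s₁
    rcases hl0 : s₁.toList with _ | ⟨p, ps⟩
    · refine ⟨[], ?_, by simp, by simp, List.isChain_nil⟩
      rw [← hlprod, hl0]
    · rw [hl0] at hl hlprod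
      have hp := hl p List.mem_cons_self
      have hps : ∀ q ∈ ps, q ≠ ⊥ ∧ (Ideal.absNorm q : ℝ) ≤ Y := fun q hq =>
        ⟨(hl q (List.mem_cons_of_mem p hq)).2, (hl q (List.mem_cons_of_mem p hq)).1⟩
      obtain ⟨L, hprod, hL, hch, -⟩ := exists_blocks Y ps p hp.2 hp.1 hps
      refine ⟨L, ?_, fun J hJ => (hL J hJ).2, fun J hJ => (hL J hJ).1, hch⟩
      rw [hprod, ← List.prod_cons, hlprod]
  -- `t ≤ 2n - 1`
  have hlen : L.length ≤ 2 * n - 1 := by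
    by_contra hlt
    push Not at hlt
    have h2 : 2 ≤ L.length := by omega
    have hstrict := pow_length_div_two_lt_absNorm_prod hY0 hLne hLch h2
    have hdvd : L.prod ∣ I := ⟨s₂.prod, by rw [hLprod, hI12]⟩
    have hle : (Ideal.absNorm L.prod : ℝ) ≤ Ideal.absNorm I := by
      exact_mod_cast Nat.le_of_dvd (Nat.pos_of_ne_zero hNI)
        (Ideal.absNorm_dvd_absNorm_of_le (Ideal.le_of_dvd hdvd))
    have hn2 : n ≤ L.length / 2 := by omega
    have hpow : Y ^ n ≤ Y ^ (L.length / 2) := pow_le_pow_right₀ hY1 hn2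
    rw [hYn] at hpow
    linarith
  -- the block of largest `τ`
  by_cases hL0 : L = []
  · -- no small primes: `I = I₂`, take `J = 1`
    refine ⟨1, one_dvd I, ?_, ?_⟩
    · rw [map_one, Nat.cast_one]; exact hY1
    · have hI2 : I = s₂.prod := by rw [← hI12, ← hLprod, hL0, List.prod_nil, one_mul]
      have h1 : 1 ≤ idealDivisorCount (1 : Ideal (𝓞 K)) := one_le_idealDivisorCount one_ne_zero
      calc idealDivisorCount I = idealDivisorCount s₂.prod := by rw [← hI2]
        _ ≤ 2 ^ (n - 1) := hτ2
        _ = 2 ^ (n - 1) * 1 ^ (2 * n - 1) := by rw [one_pow, mul_one]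
        _ ≤ 2 ^ (n - 1) * idealDivisorCount (1 : Ideal (𝓞 K)) ^ (2 * n - 1) :=
            Nat.mul_le_mul_left _ (Nat.pow_le_pow_left h1 _)
  · obtain ⟨x, hx⟩ := List.exists_mem_of_ne_nil L hL0
    obtain ⟨Jm, hJm, hmax⟩ := Finset.exists_max_image L.toFinset idealDivisorCount
      ⟨x, List.mem_toFinset.mpr hx⟩
    rw [List.mem_toFinset] at hJm
    have hmax' : ∀ J ∈ L, idealDivisorCount J ≤ idealDivisorCount Jm := fun J hJ =>
      hmax J (List.mem_toFinset.mpr hJ)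
    have hB1 : 1 ≤ idealDivisorCount Jm := one_le_idealDivisorCount (hLne Jm hJm)
    have hLprod0 : L.prod ≠ ⊥ := by rw [hLprod]; exact h10
    refine ⟨Jm, ?_, hLnorm Jm hJm, ?_⟩
    · exact dvd_trans (List.dvd_prod hJm) ⟨s₂.prod, by rw [hLprod, hI12]⟩
    · calc idealDivisorCount I = idealDivisorCount (L.prod * s₂.prod) := by rw [hLprod, hI12]
        _ ≤ idealDivisorCount L.prod * idealDivisorCount s₂.prod :=
            idealDivisorCount_mul_le hLprod0 h20
        _ ≤ (L.map idealDivisorCount).prod * 2 ^ (n - 1) :=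
            Nat.mul_le_mul (idealDivisorCount_list_prod_le L hLne) hτ2
        _ ≤ idealDivisorCount Jm ^ L.length * 2 ^ (n - 1) :=
            Nat.mul_le_mul_right _ (list_prod_map_le_pow hmax')
        _ ≤ idealDivisorCount Jm ^ (2 * n - 1) * 2 ^ (n - 1) :=
            Nat.mul_le_mul_right _ (Nat.pow_le_pow_right hB1 hlen)
        _ = 2 ^ (n - 1) * idealDivisorCount Jm ^ (2 * n - 1) := mul_comm _ _

end Literature.NumberTheory.Sieve.CubicSieve

end
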